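import Summits.Langlands.Langlands.Theses.QuarterDeficit1951
import Literature.NumberTheory.GaloisRepresentations.GaloisRepUnramifiedProofs
import Literature.NumberTheory.GaloisRepresentations.TateUnramifiedLiftingHolds
import Literature.NumberTheory.GaloisRepresentations.DirichletCharacterOfGaloisCharacter
import Literature.FieldTheory.AlgClosed.PadicAlgClEquivComplex
import Literature.NumberTheory.Automorphic.BCDTTheoremBWildAtThreeDet
import Literature.NumberTheory.GaloisRepresentations.TameInertiaGlobalCyclic
import Literature.NumberTheory.Automorphic.LanglandsTetrahedral

/-!
# Route `QuarterDeficit1951` (Langlands) — crux `IcosahedralSupply`: cyclic inertia image at `1951`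

Auxiliary registered helper for the stub `stub_dmLocal1951` (line `Sketch`): for any homomorphism
`e₀ : Γ_ℚ → S₅` with open kernel and any prime `𝔓` of `ℤ̄` above `1951`, the image `e₀(I_𝔓)` of
the inertia group is cyclic, generated by the image of one element of `I_𝔓`.

* Wild inertia dies: an element of `Γ_ℚ^u(𝔓)`, `u > 0`, acts on the finite `Γ_ℚ`-set `S₅` (left
  multiplication through `e₀`, open pointwise stabiliser `ker e₀`) through an element of
  `1951`-power order, and `#S₅ = 120` is prime to `1951`.
* The tame quotient of `I_𝔓` is pro-cyclic (Serre, *Corps locaux*, IV §2, Cor. 1 of Prop. 7), in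
  the tree's form `exists_map_inertia_eq_zpowers_of_forall_absUpperRamificationSubgroup`.
-/

set_option linter.dupNamespace false

noncomputable section

open scoped NumberField MatrixGroups
open Field IsDedekindDomain Polynomial
open Literature.NumberTheory.GaloisRepresentations Literature.NumberTheory.PAdicHodge

namespace Summit.Langlands.Langlands.Theorems.QuarterDeficit1951

/-- An element `σ` of a wild ramification group `Γ_K^u(𝔓)`, `u > 0`, at a prime `𝔓 ∣ v ∣ p`, is
mapped by a homomorphism `e : Γ_K → H` with open kernel to an element of `p`-power order:
`e (σ ^ p ^ k) = 1` for some `k`.  The action of `Γ_K` on the `Γ_K`-set `H` (left multiplication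
through `e`) has the open pointwise stabiliser `ker e`, so it factors through a finite Galois
group in which `σ` lands in the `p`-group `G₁` (the tree's `exists_pow_prime_pow_smul_eq_self`;
Serre, *Corps locaux*, IV §2, Cor. 3 of Prop. 7). [folklore] -/
theorem exists_map_pow_prime_pow_eq_one_of_isOpen_ker
    {K : Type*} [Field K] [NumberField K] {H : Type*} [Group H] (e : absoluteGaloisGroup K →* H)
    (hker : IsOpen ((e.ker : Subgroup (absoluteGaloisGroup K)) : Set (absoluteGaloisGroup K)))
    {v : HeightOneSpectrum (𝓞 K)} {𝔓 : Ideal (absIntegers (𝓞 K) K)} (h𝔓 : 𝔓 ∈ v.primesAbove)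
    {p : ℕ} (hpv : (p : 𝓞 K) ∈ v.asIdeal) {u : ℝ} (hu : 0 < u) {σ : absoluteGaloisGroup K}
    (hσ : σ ∈ absUpperRamificationSubgroup (𝓞 K) 𝔓 u) :
    ∃ k : ℕ, e (σ ^ p ^ k) = 1 := by
  letI : MulAction (absoluteGaloisGroup K) H := MulAction.compHom _ e
  have hopen : IsOpen {τ : absoluteGaloisGroup K | ∀ x : H, τ • x = x} := by
    have hset : {τ : absoluteGaloisGroup K | ∀ x : H, τ • x = x} =
        ((e.ker : Subgroup (absoluteGaloisGroup K)) : Set (absoluteGaloisGroup K)) := by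
      ext τ
      simp only [Set.mem_setOf_eq, SetLike.mem_coe, MonoidHom.mem_ker]
      constructor
      · intro hτ
        have h1 := hτ 1
        change e τ * 1 = 1 at h1
        rwa [mul_one] at h1
      · intro hτ x
        change e τ * x = x
        rw [hτ, one_mul]
    rw [hset]
    exact hker
  obtain ⟨k, hk⟩ :=
    Literature.NumberTheory.Automorphic.BCDT.exists_pow_prime_pow_smul_eq_self h𝔓 hpv hu hσ H hopen
  refine ⟨k, ?_⟩
  have h1 := hk 1
  change e (σ ^ p ^ k) * 1 = 1 at h1
  rwa [mul_one] at h1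

/-- A permutation of five letters killed by a power of `1951` is trivial: its order divides both
`1951 ^ k` and `#S₅ = 120`, which are coprime. [folklore] -/
theorem perm_fin_five_eq_one_of_pow_pow_eq_one {g : Equiv.Perm (Fin 5)} {k : ℕ}
    (h : g ^ 1951 ^ k = 1) : g = 1 := by
  have h1 : orderOf g ∣ 1951 ^ k := orderOf_dvd_of_pow_eq_one h
  have hcard : Fintype.card (Equiv.Perm (Fin 5)) = 120 := by
    rw [Fintype.card_perm, Fintype.card_fin]; rfl
  have h2 : orderOf g ∣ 120 := hcard ▸ orderOf_dvd_card
  have hcop : Nat.Coprime (1951 ^ k) 120 := Nat.Coprime.pow_left k (by norm_num)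
  exact orderOf_eq_one_iff.mp ((hcop.coprime_dvd_left h1).eq_one_of_dvd h2)

/-- **Helper stub for `stub_dmLocal1951` (cyclic inertia image at `1951`).** For a homomorphism
`e₀ : Γ_ℚ → S₅` with open kernel and a prime `𝔓` of `ℤ̄` above `1951`, the image `e₀(I_𝔓)` of the
inertia group is generated by the image of a single element of `I_𝔓`: wild inertia (pro-`1951`)
dies in `S₅` (`120` is prime to `1951`), and the tame quotient of `I_𝔓` is pro-cyclic.
[cite: SerreLocalFields1979, Ch. IV §2 Cor. 1 and Cor. 3 of Prop. 7] -/
theorem dmLocal1951_inertia_map_eq_zpowers (e₀ : absoluteGaloisGroup ℚ →* Equiv.Perm (Fin 5))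
    (hker : IsOpen ((e₀.ker : Subgroup (absoluteGaloisGroup ℚ)) : Set (absoluteGaloisGroup ℚ))) :
    ∀ v : HeightOneSpectrum (𝓞 ℚ), v.residueCard = 1951 → ∀ 𝔓 ∈ v.primesAbove,
      ∃ s ∈ 𝔓.inertia (absoluteGaloisGroup ℚ),
        (𝔓.inertia (absoluteGaloisGroup ℚ)).map e₀ = Subgroup.zpowers (e₀ s) := by
  intro v hv 𝔓 h𝔓
  have hp : Nat.Prime 1951 := by norm_num
  -- `1951 ∈ v`
  have hpv : ((1951 : ℕ) : 𝓞 ℚ) ∈ v.asIdeal := by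
    rw [Literature.NumberTheory.EllipticCurves.natCast_mem_asIdeal_iff_eq_primesEquiv_symm v hp,
      Equiv.eq_symm_apply]
    rw [FramedRep.residueCard_eq_coe_primesEquiv'] at hv
    exact Subtype.ext hv
  -- wild inertia dies in `S₅`
  have hwild : ∀ u : ℝ, 0 < u → ∀ σ ∈ absUpperRamificationSubgroup (𝓞 ℚ) 𝔓 u, e₀ σ = 1 := by
    intro u hu σ hσ
    obtain ⟨k, hk⟩ := exists_map_pow_prime_pow_eq_one_of_isOpen_ker e₀ hker h𝔓 hpv hu hσ
    rw [map_pow] at hk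
    exact perm_fin_five_eq_one_of_pow_pow_eq_one hk
  -- the tame image is cyclic, generated by the image of an inertia element
  letI : TopologicalSpace (Equiv.Perm (Fin 5)) := ⊥
  haveI : DiscreteTopology (Equiv.Perm (Fin 5)) := ⟨rfl⟩
  have hcont : Continuous e₀ :=
    Literature.NumberTheory.Automorphic.MonoidHom.continuous_of_isOpen_ker e₀ hker
  let f : absoluteGaloisGroup ℚ →ₜ* Equiv.Perm (Fin 5) := ⟨e₀, hcont⟩
  obtain ⟨s, hs, h⟩ :=
    exists_map_inertia_eq_zpowers_of_forall_absUpperRamificationSubgroup h𝔓 f hwild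
  exact ⟨s, hs, h⟩

end Summit.Langlands.Langlands.Theorems.QuarterDeficit1951

end
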